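import Literature.NumberTheory.Sieve.HeathBrownWeightMass
import Literature.NumberTheory.Sieve.HeathBrownWeightClassSums
import Literature.NumberTheory.Sieve.CubicFormClassWeightIdentity
import Literature.NumberTheory.Sieve.CubicClassCountUpperTransfer
import Literature.NumberTheory.Sieve.RoughModelVarianceExpansion
import HarnessLib

/-!
# Class sums of the Heath-Brown weight from the class asymptotics («ClassTransfer»), PROVED

Topic `Literature/NumberTheory/Sieve`, namespace `Literature.NumberTheory.Sieve.CubicMinorant`
(continuation of `HeathBrownWeightMass.lean`, `HeathBrownWeightClassSums.lean`,
`CubicFormClassWeightIdentity.lean`, `CubicClassCountUpperTransfer.lean`).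

The TRANSFER of Heath-Brown–Moroz's residue-class asymptotics for the primes `x³ + 2y³`,
`π(𝒜; d, a, b)(X, (log X)^{−c}) = w(d) M(X) (1 + o(1))` for the admissible classes `(a, b) mod d`,
`d ≤ Q` [HeathBrownMoroz2004, Thm 2, §3 (3.1)], to the weight
`f₃(k) = N^{1/3} log k · #{(x, y) ∈ primePairs(X_N, η_N) : x³ + 2y³ = k}` of the parity-ideate
cubic-minorant programme (`CubicMinorantDefs.lean`):

* (i) the MASS `U = ∑_{k ≤ N} f₃(k) ≥ (σ₀ 6^{−2/3}/2) η_N² N` for `N ≥ N₀` — the `d = 1` case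
  (`hbWeight_mass_lower_of_classAsymptotic`, [HeathBrownActa2001, Thm 1]);
* (ii) the CLASS SUMS `U_d(r) = ∑_{k ≤ N, k ≡ r (d)} f₃(k) = ρ(d, r) U (1 ± ε)` uniformly over the
  squarefree `d ≤ Q` and all `r`, where `ρ(d, r) = #{(a,b) mod d : a³+2b³ ≡ r, (a³+2b³, d) = 1}/ν*_d`
  is the local density of the value `r` (`classTransfer`, VERBATIM the support item «ClassTransfer»
  of the parity-ideate route `GoldbachHeathBrownDispersion`, in its `1 ≤ Q` form).

Method (no sieve): UPPER bounds `U_d(r) ≤ (ρ(d,r) + ε) U` for `(r, d) = 1` from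
`U_d(r) ≤ N^{1/3} log N · ∑_{(a,b): a³+2b³ ≡ r} #{pairs ≡ (a,b)}` (`sum_hbWeight_modEq_le_card`,
`card_primePairs_modEq_eq_sum_classes`), the sieve-free upper class transfer
`#{pairs ≡ (a,b)} ≤ (w(d) + ε₁) M(X_N)/d²` (`card_class_le_of_classAsymptotic`: Heath-Brown's class box
lies inside a Heath-Brown–Moroz box), the mass from below `U ≥ N^{1/3} · 3 log X · (1 − ε₁) M(X_N)`
(`d = 1`), `log N = (1 + o(1)) · 3 log X_N` and the local-density identity `ρ(d,r) = ν_d(r) w(d)/d²`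
(`classDensity_eq_classWeight_div_sq_mul`); for `(r, d) > 1` both sides vanish
(`sum_hbWeight_modEq_eq_zero_of_not_coprime`).  LOWER bounds then follow from the upper ones through
the partitions `∑_{r<d} U_d(r) = U` (`sum_range_sum_filter_modEq`) and `∑_{r<d} ρ(d,r) = 1`
(`sum_range_classDensity_eq_one`): `U_d(r) ≥ (ρ(d,r) − (d−1)ε) U` (`abs_sub_mul_le_of_forall_le`).
No new facts (0 `def … : Prop`).  Written for the parity-ideate cell (route
`GoldbachHeathBrownDispersion`, support item stmt-Parity-20359; literature seat g15, 2026-08-27).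

## References

* [HeathBrownMoroz2004] D. R. Heath-Brown, B. Z. Moroz, *On primes represented by cubic polynomials*,
  Proc. LMS (3) 88 (2004), Theorem 2, §3 (3.1).
* [HeathBrownActa2001] D. R. Heath-Brown, *Primes represented by x³ + 2y³*, Acta Math. 186 (2001),
  Theorem 1, §2 (2.2).

## Mathlib / tree search

Tree: `hbWeight_mass_lower_of_classAsymptotic`, `sum_hbWeight_ge`, `sum_hbRep_eq_primePairCount`,
`card_primePairs_modEq_eq_sum_classes` (`HeathBrownWeightMass`); `sum_hbWeight_modEq_le_card`,
`sum_hbWeight_modEq_eq_zero_of_not_coprime`, `cubicClassCount_eq_of_coprime`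
(`HeathBrownWeightClassSums`); `classDensity_eq_classWeight_div_sq_mul`, `card_coprimeClasses_pos`
(`CubicFormClassWeightIdentity`); `card_class_le_of_classAsymptotic` (`CubicClassCountUpperTransfer`);
`sum_range_sum_filter_modEq` (`RoughModelVarianceExpansion`); `tendsto_hbX`, `tendsto_hbEta`,
`hbX_pow_three` (`HeathBrownWeightFourthMoment`).
Mathlib: `Filter.eventually_all_finset`, `Finset.card_eq_sum_card_fiberwise`, `Finset.add_sum_erase`.
`lean search 'classTransfer|classDensity'`: only the identity file above before this file.
-/

noncomputable section

open Finset Filter Topology Asymptotics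
open Literature.NumberTheory.Sieve.CubicPrimes

namespace Literature.NumberTheory.Sieve.CubicMinorant

/-! ### The local densities `ρ(d, r)` partition unity -/

/-- A value `r` NOT coprime to `d` has no admissible class: `#{(a,b) mod d : a³+2b³ ≡ r,
(a³+2b³, d) = 1} = 0`. [cite: HeathBrownMoroz2004, §3 (3.1)] -/
theorem card_classNumerator_eq_zero_of_not_coprime {d r : ℕ} (hr : ¬ Nat.Coprime r d) :
    #{ab ∈ range d ×ˢ range d | ab.1 ^ 3 + 2 * ab.2 ^ 3 ≡ r [MOD d] ∧
        Nat.Coprime (ab.1 ^ 3 + 2 * ab.2 ^ 3) d} = 0 := by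
  rw [card_eq_zero, filter_eq_empty_iff]
  intro ab _ h
  apply hr
  rw [Nat.Coprime, ← h.1.gcd_eq]
  exact h.2

/-- **The local densities sum to one**: for squarefree `d`,
`∑_{r < d} #{(a,b) mod d : a³+2b³ ≡ r, admissible}/ν*_d = 1` (the admissible classes are
partitioned by the value of `a³ + 2b³ mod d`; `ν*_d ≥ 1`). [cite: HeathBrownMoroz2004, §3 (3.1)] -/
theorem sum_range_classDensity_eq_one {d : ℕ} (hd : Squarefree d) :
    ∑ r ∈ range d,
      (#{ab ∈ range d ×ˢ range d | ab.1 ^ 3 + 2 * ab.2 ^ 3 ≡ r [MOD d] ∧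
          Nat.Coprime (ab.1 ^ 3 + 2 * ab.2 ^ 3) d} : ℝ) /
        (#{ab ∈ range d ×ˢ range d | Nat.Coprime (ab.1 ^ 3 + 2 * ab.2 ^ 3) d} : ℝ) = 1 := by
  have hd0 : 0 < d := Nat.pos_of_ne_zero fun h => not_squarefree_zero (h ▸ hd)
  have hν := card_coprimeClasses_pos hd
  have hν' : (#{ab ∈ range d ×ˢ range d | Nat.Coprime (ab.1 ^ 3 + 2 * ab.2 ^ 3) d} : ℝ) ≠ 0 := by
    exact_mod_cast hν.ne'
  rw [← sum_div, div_eq_one_iff_eq hν', ← Nat.cast_sum, Nat.cast_inj]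
  have hfib := card_eq_sum_card_fiberwise
    (s := {ab ∈ range d ×ˢ range d | Nat.Coprime (ab.1 ^ 3 + 2 * ab.2 ^ 3) d}) (t := range d)
    (f := fun ab : ℕ × ℕ => (ab.1 ^ 3 + 2 * ab.2 ^ 3) % d)
    (fun ab _ => mem_coe.mpr (mem_range.mpr (Nat.mod_lt _ hd0)))
  rw [hfib]
  refine sum_congr rfl fun r hr => ?_
  rw [filter_filter]
  congr 1
  refine filter_congr fun ab _ => ?_
  rw [Nat.ModEq, Nat.mod_eq_of_lt (mem_range.mp hr)]
  tauto

/-! ### Two-sided bounds from one-sided ones over a partition -/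

/-- **Lower bounds from upper bounds over a partition**: if `∑_{i ∈ s} u_i = U ≥ 0`,
`∑_{i ∈ s} ρ_i = 1` and `u_i ≤ (ρ_i + ε) U` for every `i ∈ s` (`ε ≥ 0`), then
`|u_i − ρ_i U| ≤ #s · ε · U` for every `i ∈ s` (indeed `u_i = U − ∑_{j ≠ i} u_j ≥
(ρ_i − (#s − 1)ε) U`; private helper). [folklore] -/
private theorem abs_sub_mul_le_of_forall_le {ι : Type*} (s : Finset ι) (u ρ : ι → ℝ) {U ε : ℝ}
    (hU : 0 ≤ U) (hε : 0 ≤ ε) (hsum : ∑ i ∈ s, u i = U) (hρ : ∑ i ∈ s, ρ i = 1)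
    (hup : ∀ i ∈ s, u i ≤ (ρ i + ε) * U) {i : ι} (hi : i ∈ s) :
    |u i - ρ i * U| ≤ #s * ε * U := by
  classical
  have hpos : 0 < #s := card_pos.mpr ⟨i, hi⟩
  have hcard : (1 : ℝ) ≤ #s := by exact_mod_cast hpos
  have hεU : 0 ≤ ε * U := mul_nonneg hε hU
  rw [abs_le]
  constructor
  · -- lower bound through the complement
    have hu : u i = U - ∑ j ∈ s.erase i, u j := by
      rw [← hsum, ← add_sum_erase s u hi]; ring
    have hρ' : ρ i = 1 - ∑ j ∈ s.erase i, ρ j := by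
      rw [← hρ, ← add_sum_erase s ρ hi]; ring
    have hle : ∑ j ∈ s.erase i, u j ≤ ∑ j ∈ s.erase i, (ρ j + ε) * U :=
      sum_le_sum fun j hj => hup j (mem_of_mem_erase hj)
    have hexp : ∑ j ∈ s.erase i, (ρ j + ε) * U =
        (∑ j ∈ s.erase i, ρ j) * U + ((#s : ℝ) - 1) * ε * U := by
      rw [← sum_mul, sum_add_distrib, sum_const, nsmul_eq_mul, card_erase_of_mem hi,
        Nat.cast_sub hpos, Nat.cast_one]
      ring
    rw [hexp] at hle
    rw [hu, hρ']
    nlinarith [hle, hεU]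
  · have := hup i hi
    nlinarith [this, hεU]

/-! ### Two qualitative inputs: `log N ∼ 3 log X` and the mass from below -/

/-- `log N ≤ (1 + ε) · 3 log X` for all large `N` (`X = (N/6)^{1/3}`, so `3 log X = log N − log 6`).
[cite: HeathBrownActa2001, Theorem 1 (X³ = N/6)] -/
theorem eventually_log_le_mul_three_log_hbX {ε : ℝ} (hε : 0 < ε) :
    ∀ᶠ N : ℕ in atTop, Real.log N ≤ (1 + ε) * (3 * Real.log (hbX N)) := by
  have hlog : Tendsto (fun N : ℕ => Real.log (N : ℝ)) atTop atTop :=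
    Real.tendsto_log_atTop.comp (tendsto_natCast_atTop_atTop (R := ℝ))
  filter_upwards [hlog.eventually_ge_atTop ((1 + ε) * Real.log 6 / ε), eventually_ge_atTop 1]
    with N hN hN1
  have hN0 : (N : ℝ) ≠ 0 := Nat.cast_ne_zero.mpr (by omega)
  have h3 : 3 * Real.log (hbX N) = Real.log N - Real.log 6 := by
    rw [← Real.log_div hN0 (by norm_num), ← hbX_pow_three N, Real.log_pow]
    norm_num
  rw [h3]
  have hkey : (1 + ε) * Real.log 6 ≤ ε * Real.log N := by
    have := hN
    rw [div_le_iff₀ hε] at this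
    linarith
  linarith

/-- **The mass from below with a relative error**: if `π(𝒜)(X, (log X)^{−c}) − w(1) M(X) = o(M(X))`
(`M = mainTerm c σ₀`), then for every `ε > 0` and all large `N`,
`N^{1/3} · 3 log X_N · (1 − ε) M(X_N) ≤ ∑_{k ≤ N} f₃(k)` (every counted prime exceeds `X³`, and all
of them are `≤ N`). [cite: HeathBrownActa2001, Theorem 1 (π(𝒜) = σ₀ η²X²/(3 log X)(1 + o(1)))] -/
theorem eventually_mass_ge_of_classAsymptotic {c σ₀ : ℝ} (hc : 0 < c) (hσ : 0 < σ₀)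
    (h1 : IsLittleO atTop
      (fun X : ℝ => (residueClassPrimeCount X (Real.log X ^ (-c)) 1 0 0 : ℝ) -
        classWeight 1 * mainTerm c σ₀ X)
      (fun X : ℝ => mainTerm c σ₀ X)) {ε : ℝ} (hε : 0 < ε) :
    ∀ᶠ N : ℕ in atTop,
      (N : ℝ) ^ ((1 : ℝ) / 3) * (3 * Real.log (hbX N)) * ((1 - ε) * mainTerm c σ₀ (hbX N)) ≤
        ∑ k ∈ Icc 1 N, hbWeight c N k := by
  have e1 := tendsto_hbX.eventually (h1.def hε)
  have e2 := tendsto_hbX.eventually_gt_atTop (1 : ℝ)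
  have e3 := (tendsto_hbEta hc).eventually
    (eventually_le_nhds (show (0 : ℝ) < 1 / 4 by norm_num))
  filter_upwards [e1, e2, e3] with N hclose hX1 hη4
  have hX0 : 0 < hbX N := by linarith
  have hlogX : 0 < Real.log (hbX N) := Real.log_pos hX1
  have hη0 : 0 ≤ hbEta c N := by
    unfold hbEta; exact Real.rpow_nonneg hlogX.le _
  have hη2 : (1 + hbEta c N) ^ 3 ≤ 2 := by
    calc (1 + hbEta c N) ^ 3 ≤ (1 + 1 / 4) ^ 3 :=
          pow_le_pow_left₀ (by linarith) (by linarith) 3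
      _ ≤ 2 := by norm_num
  have hMT : 0 < mainTerm c σ₀ (hbX N) := mainTerm_pos hσ hX1
  rw [classWeight_one, one_mul, Real.norm_eq_abs, Real.norm_eq_abs, abs_of_pos hMT] at hclose
  have hcount : (1 - ε) * mainTerm c σ₀ (hbX N) ≤ (primePairCount (hbX N) (hbEta c N) : ℝ) := by
    rw [hbEta, ← residueClassPrimeCount_one_zero_zero]
    have := (abs_le.mp hclose).1
    linarith
  have hsum : (∑ n ∈ Icc 1 N, (hbRep c N n : ℝ)) = primePairCount (hbX N) (hbEta c N) := by
    rw [← Nat.cast_sum, sum_hbRep_eq_primePairCount hη2 hη0]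
  have hge := sum_hbWeight_ge (c := c) hX1.le
  rw [hsum] at hge
  refine le_trans ?_ hge
  exact mul_le_mul_of_nonneg_left hcount
    (mul_nonneg (Real.rpow_nonneg (Nat.cast_nonneg N) _) (by positivity))

/-! ### The upper bound for one class sum -/

/-- The `ε`-budget of the upper class-sum bound: for `ρ, t ≤ 1` and `0 < ε ≤ 1`,
`(1 + ε/5)(ρ + (ε/5) t) ≤ (1 − ε/5)(ρ + ε)`. [folklore] -/
private theorem upper_budget {ρ t ε : ℝ} (hρ1 : ρ ≤ 1) (ht1 : t ≤ 1) (hε : 0 < ε) (hε1 : ε ≤ 1) :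
    (1 + ε / 5) * (ρ + ε / 5 * t) ≤ (1 - ε / 5) * (ρ + ε) := by
  have p1 : 0 ≤ ε * (1 - ρ) := mul_nonneg hε.le (by linarith)
  have p2 : 0 ≤ ε * (1 - t) := mul_nonneg hε.le (by linarith)
  have p3 : 0 ≤ ε * (1 - ε) := mul_nonneg hε.le (by linarith)
  have het : ε * t ≤ 1 := by nlinarith
  have p4 : 0 ≤ ε * (1 - ε / 5 * t) := mul_nonneg hε.le (by linarith)
  nlinarith [p1, p2, p3, p4]

/-- **Upper bound for a class sum of `f₃`** from the class asymptotics at `(Q, c, σ₀)`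
[HeathBrownMoroz2004, Thm 2]: for squarefree `d ≤ Q`, any `r` and `0 < ε ≤ 1`, for all large `N`,
`∑_{k ≤ N, k ≡ r (d)} f₃(k) ≤ (ρ(d, r) + ε) · ∑_{k ≤ N} f₃(k)` — for `(r, d) = 1` via the classes
`(a, b)` with `a³ + 2b³ ≡ r` (all admissible), the sieve-free upper class transfer, the mass from
below and `ρ(d, r) = ν_d(r) w(d)/d²`; for `(r, d) > 1` the class sum vanishes.
[cite: HeathBrownMoroz2004, Theorem 2 and §3 (3.1)] -/
theorem eventually_classSum_le {Q : ℕ} {c σ₀ : ℝ} (hc : 0 < c) (hσ : 0 < σ₀)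
    (h : ∀ d a b : ℕ, 0 < d → d ≤ Q → Nat.Coprime (a ^ 3 + 2 * b ^ 3) d →
      IsLittleO atTop
        (fun X : ℝ => (residueClassPrimeCount X (Real.log X ^ (-c)) d a b : ℝ) -
          classWeight d * mainTerm c σ₀ X)
        (fun X : ℝ => mainTerm c σ₀ X))
    {d : ℕ} (hd : 0 < d) (hdQ : d ≤ Q) (hsf : Squarefree d) (r : ℕ) {ε : ℝ} (hε : 0 < ε)
    (hε1 : ε ≤ 1) :
    ∀ᶠ N : ℕ in atTop,
      ∑ k ∈ (Icc 1 N).filter (fun k : ℕ => k ≡ r [MOD d]), hbWeight c N k ≤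
        ((#{ab ∈ range d ×ˢ range d | ab.1 ^ 3 + 2 * ab.2 ^ 3 ≡ r [MOD d] ∧
              Nat.Coprime (ab.1 ^ 3 + 2 * ab.2 ^ 3) d} : ℝ) /
            (#{ab ∈ range d ×ˢ range d | Nat.Coprime (ab.1 ^ 3 + 2 * ab.2 ^ 3) d} : ℝ) + ε) *
          ∑ k ∈ Icc 1 N, hbWeight c N k := by
  have hQ : 1 ≤ Q := le_trans hd hdQ
  have hU0 : ∀ N : ℕ, 0 ≤ ∑ k ∈ Icc 1 N, hbWeight c N k := fun N =>
    sum_nonneg fun k _ => hbWeight_nonneg c N k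
  have hρ0 : 0 ≤ (#{ab ∈ range d ×ˢ range d | ab.1 ^ 3 + 2 * ab.2 ^ 3 ≡ r [MOD d] ∧
        Nat.Coprime (ab.1 ^ 3 + 2 * ab.2 ^ 3) d} : ℝ) /
      (#{ab ∈ range d ×ˢ range d | Nat.Coprime (ab.1 ^ 3 + 2 * ab.2 ^ 3) d} : ℝ) :=
    div_nonneg (Nat.cast_nonneg _) (Nat.cast_nonneg _)
  by_cases hr : Nat.Coprime r d
  · -- the coprime case
    have hε₁0 : 0 < ε / 5 := by positivity
    -- the classes `(a, b)` with `a³ + 2b³ ≡ r` are admissible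
    have hadm : ∀ ab ∈ (range d ×ˢ range d).filter
        (fun ab : ℕ × ℕ => ab.1 ^ 3 + 2 * ab.2 ^ 3 ≡ r [MOD d]),
        ab.1 < d ∧ ab.2 < d ∧ Nat.Coprime (ab.1 ^ 3 + 2 * ab.2 ^ 3) d := by
      intro ab hab
      rw [mem_filter, mem_product, mem_range, mem_range] at hab
      refine ⟨hab.1.1, hab.1.2, ?_⟩
      rw [Nat.Coprime, hab.2.gcd_eq]
      exact hr
    -- (E2) the upper class transfer, uniformly over the finitely many classes
    have E2 : ∀ᶠ N : ℕ in atTop, ∀ ab ∈ (range d ×ˢ range d).filter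
        (fun ab : ℕ × ℕ => ab.1 ^ 3 + 2 * ab.2 ^ 3 ≡ r [MOD d]),
        (#{xy ∈ primePairs (hbX N) (hbEta c N) | xy.1 ≡ ab.1 [MOD d] ∧ xy.2 ≡ ab.2 [MOD d]} : ℝ) ≤
          (classWeight d + ε / 5) * mainTerm c σ₀ (hbX N) / (d : ℝ) ^ 2 := by
      refine (eventually_all_finset _).mpr fun ab hab => ?_
      obtain ⟨ha, hb, hcop⟩ := hadm ab hab
      exact card_class_le_of_classAsymptotic hd ha hb hc hσ (h d ab.1 ab.2 hd hdQ hcop) (ε / 5) hε₁0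
    -- (E1) the mass from below, (E3) `log N ≤ (1 + ε/5) 3 log X`, (E4) `X > 1`
    have E1 := eventually_mass_ge_of_classAsymptotic hc hσ
      (h 1 0 0 one_pos hQ (Nat.coprime_one_right _)) hε₁0
    have E3 := eventually_log_le_mul_three_log_hbX hε₁0
    have E4 := tendsto_hbX.eventually_gt_atTop (1 : ℝ)
    filter_upwards [E1, E2, E3, E4] with N h1 h2 h3 hX1
    -- abbreviations
    set U : ℝ := ∑ k ∈ Icc 1 N, hbWeight c N k with hUdef
    set S : ℝ := ∑ k ∈ (Icc 1 N).filter (fun k : ℕ => k ≡ r [MOD d]), hbWeight c N k with hSdef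
    set A : ℕ := #{ab ∈ range d ×ˢ range d | ab.1 ^ 3 + 2 * ab.2 ^ 3 ≡ r [MOD d] ∧
        Nat.Coprime (ab.1 ^ 3 + 2 * ab.2 ^ 3) d} with hAdef
    set ν : ℕ := #{ab ∈ range d ×ˢ range d | Nat.Coprime (ab.1 ^ 3 + 2 * ab.2 ^ 3) d} with hνdef
    set M : ℝ := mainTerm c σ₀ (hbX N) with hMdef
    set L : ℝ := (N : ℝ) ^ ((1 : ℝ) / 3) with hLdef
    set lX : ℝ := Real.log (hbX N) with hlXdef
    set w : ℝ := classWeight d with hwdef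
    have hM : 0 < M := mainTerm_pos hσ hX1
    have hlX : 0 < lX := Real.log_pos hX1
    have hL : 0 ≤ L := Real.rpow_nonneg (Nat.cast_nonneg N) _
    have hw : 0 < w := classWeight_pos d
    have hd' : (0 : ℝ) < d := by exact_mod_cast hd
    have hlN0 : 0 ≤ Real.log N := Real.log_natCast_nonneg N
    -- Step 1: `S ≤ L log N · #{pairs ≡ r} ≤ L log N · A (w + ε/5) M/d²`
    have hcount : (#{xy ∈ primePairs (hbX N) (hbEta c N) |
          xy.1 ^ 3 + 2 * xy.2 ^ 3 ≡ r [MOD d]} : ℝ) ≤ A * ((w + ε / 5) * M / (d : ℝ) ^ 2) := by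
      rw [card_primePairs_modEq_eq_sum_classes _ _ hd r, Nat.cast_sum]
      refine (sum_le_sum h2).trans ?_
      rw [sum_const, nsmul_eq_mul, ← cubicClassCount_def, cubicClassCount_eq_of_coprime hr]
    have g1 : S ≤ L * Real.log N * (A * ((w + ε / 5) * M / (d : ℝ) ^ 2)) :=
      (sum_hbWeight_modEq_le_card c N d r).trans
        (mul_le_mul_of_nonneg_left hcount (mul_nonneg hL hlN0))
    -- Step 2: `log N ≤ (1 + ε/5) 3 log X`
    have hA0 : (0 : ℝ) ≤ A := Nat.cast_nonneg A
    have g2 : L * Real.log N * (A * ((w + ε / 5) * M / (d : ℝ) ^ 2)) ≤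
        L * ((1 + ε / 5) * (3 * lX)) * (A * ((w + ε / 5) * M / (d : ℝ) ^ 2)) :=
      mul_le_mul_of_nonneg_right (mul_le_mul_of_nonneg_left h3 hL) (by positivity)
    -- Step 3: `A (w + ε/5)/d² = ρ + (ε/5)(A/d²)` with `ρ = w A/d²`, and the ε-budget
    have hρ : (A : ℝ) / ν = w / (d : ℝ) ^ 2 * A := classDensity_eq_classWeight_div_sq_mul hsf r
    have hAle : (A : ℝ) ≤ (d : ℝ) ^ 2 := by
      have hA : A ≤ #(range d ×ˢ range d) := card_filter_le _ _
      rw [card_product, card_range] at hA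
      have : (A : ℝ) ≤ (d : ℝ) * d := by exact_mod_cast hA
      simpa [sq] using this
    have hρ1 : (A : ℝ) / ν ≤ 1 := by
      refine div_le_one_of_le₀ ?_ (Nat.cast_nonneg _)
      exact_mod_cast card_le_card fun ab hab => by
        rw [mem_filter] at hab ⊢
        exact ⟨hab.1, hab.2.2⟩
    have ht1 : (A : ℝ) / (d : ℝ) ^ 2 ≤ 1 := (div_le_one (by positivity)).mpr hAle
    have ht0 : 0 ≤ (A : ℝ) / (d : ℝ) ^ 2 := by positivity
    have g3 : L * ((1 + ε / 5) * (3 * lX)) * (A * ((w + ε / 5) * M / (d : ℝ) ^ 2)) =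
        (L * (3 * lX) * M) * ((1 + ε / 5) * ((A : ℝ) / ν + ε / 5 * ((A : ℝ) / (d : ℝ) ^ 2))) := by
      rw [hρ]
      field_simp
    have g4 : (1 + ε / 5) * ((A : ℝ) / ν + ε / 5 * ((A : ℝ) / (d : ℝ) ^ 2)) ≤
        (1 - ε / 5) * ((A : ℝ) / ν + ε) := upper_budget hρ1 ht1 hε hε1
    have hK : 0 ≤ L * (3 * lX) * M := by positivity
    have g5 : (L * (3 * lX) * M) * ((1 - ε / 5) * ((A : ℝ) / ν + ε)) =
        ((A : ℝ) / ν + ε) * (L * (3 * lX) * ((1 - ε / 5) * M)) := by ring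
    -- Step 4: the mass from below
    have g6 : ((A : ℝ) / ν + ε) * (L * (3 * lX) * ((1 - ε / 5) * M)) ≤ ((A : ℝ) / ν + ε) * U :=
      mul_le_mul_of_nonneg_left h1 (add_nonneg hρ0 hε.le)
    calc S ≤ L * Real.log N * (A * ((w + ε / 5) * M / (d : ℝ) ^ 2)) := g1
      _ ≤ L * ((1 + ε / 5) * (3 * lX)) * (A * ((w + ε / 5) * M / (d : ℝ) ^ 2)) := g2
      _ = (L * (3 * lX) * M) * ((1 + ε / 5) * ((A : ℝ) / ν + ε / 5 * ((A : ℝ) / (d : ℝ) ^ 2))) := g3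
      _ ≤ (L * (3 * lX) * M) * ((1 - ε / 5) * ((A : ℝ) / ν + ε)) :=
          mul_le_mul_of_nonneg_left g4 hK
      _ = ((A : ℝ) / ν + ε) * (L * (3 * lX) * ((1 - ε / 5) * M)) := g5
      _ ≤ ((A : ℝ) / ν + ε) * U := g6
  · -- classes not coprime to `d` carry no weight once `6d ≤ N`
    filter_upwards [eventually_ge_atTop (6 * d)] with N hN
    have hdN : (d : ℝ) ≤ (N : ℝ) / 6 := by
      rw [le_div_iff₀ (by norm_num : (0 : ℝ) < 6)]
      exact_mod_cast (by omega : d * 6 ≤ N)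
    rw [sum_hbWeight_modEq_eq_zero_of_not_coprime c hd hr hdN]
    exact mul_nonneg (add_nonneg hρ0 hε.le) (hU0 N)

/-! ### The transfer -/

/-- **The class transfer** — VERBATIM the support item «ClassTransfer» (form `1 ≤ Q`) of the
parity-ideate route `GoldbachHeathBrownDispersion`: for every `Q ≥ 1`, `c, σ₀ > 0` with
`singularProductPartial → σ₀`, if the class asymptotics `π(𝒜; d, a, b)(X, (log X)^{−c}) =
w(d) M(X)(1 + o(1))` hold for every admissible class `(a, b)` to every modulus `d ≤ Q`
[HeathBrownMoroz2004, Thm 2 — finite-uniform form], then (i) the mass of the weight satisfies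
`U = ∑_{k ≤ N} f₃(k) ≥ (σ₀ 6^{−2/3}/2) η_N² N` for `N ≥ N₀`, and (ii) for every `ε > 0`, all
squarefree `d ≤ Q` and all `r < d`, `|∑_{k ≤ N, k ≡ r (d)} f₃(k) − ρ(d, r) U| ≤ ε U` for
`N ≥ N₀(ε)`, `ρ(d, r) = #{(a,b) mod d : a³+2b³ ≡ r, (a³+2b³, d) = 1}/#{(a,b) mod d : (a³+2b³, d) = 1}`.
[cite: HeathBrownMoroz2004, Theorem 2 and §3 (3.1); HeathBrownActa2001, Theorem 1] -/
theorem classTransfer :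
    ∀ Q : ℕ, 1 ≤ Q → ∀ c σ₀ : ℝ, 0 < c → 0 < σ₀ →
      Filter.Tendsto Literature.NumberTheory.Sieve.CubicPrimes.singularProductPartial Filter.atTop
        (nhds σ₀) →
      (∀ d a b : ℕ, 0 < d → d ≤ Q → Nat.Coprime (a ^ 3 + 2 * b ^ 3) d →
        Asymptotics.IsLittleO Filter.atTop
          (fun X : ℝ => (Literature.NumberTheory.Sieve.CubicPrimes.residueClassPrimeCount X
              (Real.log X ^ (-c)) d a b : ℝ) -
            Literature.NumberTheory.Sieve.CubicPrimes.classWeight d *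
              Literature.NumberTheory.Sieve.CubicPrimes.mainTerm c σ₀ X)
          (fun X : ℝ => Literature.NumberTheory.Sieve.CubicPrimes.mainTerm c σ₀ X)) →
      (∃ N₀ : ℕ, ∀ N : ℕ, N₀ ≤ N →
          σ₀ * (6 : ℝ) ^ (-(2 / 3 : ℝ)) / 2 * Literature.NumberTheory.Sieve.CubicMinorant.hbEta c N ^ 2 * N ≤
            ∑ k ∈ Finset.Icc 1 N, Literature.NumberTheory.Sieve.CubicMinorant.hbWeight c N k) ∧
      (∀ ε : ℝ, 0 < ε → ∃ N₀ : ℕ, ∀ N : ℕ, N₀ ≤ N → ∀ d : ℕ, 0 < d → d ≤ Q → Squarefree d →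
          ∀ r : ℕ, r < d →
          |(∑ k ∈ Finset.filter (fun k : ℕ => k ≡ r [MOD d]) (Finset.Icc 1 N),
                Literature.NumberTheory.Sieve.CubicMinorant.hbWeight c N k) -
              ((Finset.filter (fun xy : ℕ × ℕ => xy.1 ^ 3 + 2 * xy.2 ^ 3 ≡ r [MOD d] ∧
                    Nat.Coprime (xy.1 ^ 3 + 2 * xy.2 ^ 3) d)
                  (Finset.range d ×ˢ Finset.range d)).card : ℝ) /
                ((Finset.filter (fun xy : ℕ × ℕ => Nat.Coprime (xy.1 ^ 3 + 2 * xy.2 ^ 3) d)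
                  (Finset.range d ×ˢ Finset.range d)).card : ℝ) *
              ∑ k ∈ Finset.Icc 1 N, Literature.NumberTheory.Sieve.CubicMinorant.hbWeight c N k| ≤
            ε * ∑ k ∈ Finset.Icc 1 N, Literature.NumberTheory.Sieve.CubicMinorant.hbWeight c N k) := by
  intro Q hQ c σ₀ hc hσ _ h
  refine ⟨hbWeight_mass_lower_of_classAsymptotic Q hQ hc hσ h, fun ε hε => ?_⟩
  have hU0 : ∀ N : ℕ, 0 ≤ ∑ k ∈ Icc 1 N, hbWeight c N k := fun N =>
    sum_nonneg fun k _ => hbWeight_nonneg c N k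
  -- the one-sided tolerance `ε' = min ε 1 / Q`
  have hQ0 : (0 : ℝ) < Q := by exact_mod_cast hQ
  have hε'0 : 0 < min ε 1 / Q := div_pos (lt_min hε one_pos) hQ0
  have hε'1 : min ε 1 / Q ≤ 1 := by
    rw [div_le_one hQ0]
    exact (min_le_right _ _).trans (by exact_mod_cast hQ)
  -- upper bounds for every class sum, uniformly over `d ≤ Q` squarefree and `r < d`
  have hev : ∀ᶠ N : ℕ in atTop, ∀ d ∈ range (Q + 1), 0 < d → Squarefree d → ∀ r ∈ range d,
      ∑ k ∈ (Icc 1 N).filter (fun k : ℕ => k ≡ r [MOD d]), hbWeight c N k ≤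
        ((#{ab ∈ range d ×ˢ range d | ab.1 ^ 3 + 2 * ab.2 ^ 3 ≡ r [MOD d] ∧
              Nat.Coprime (ab.1 ^ 3 + 2 * ab.2 ^ 3) d} : ℝ) /
            (#{ab ∈ range d ×ˢ range d | Nat.Coprime (ab.1 ^ 3 + 2 * ab.2 ^ 3) d} : ℝ) +
            min ε 1 / Q) *
          ∑ k ∈ Icc 1 N, hbWeight c N k := by
    refine (eventually_all_finset _).mpr fun d hdm => ?_
    have hdQ : d ≤ Q := Nat.lt_succ_iff.mp (mem_range.mp hdm)
    by_cases hyp : 0 < d ∧ Squarefree d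
    · have hall := (eventually_all_finset (range d)).mpr fun r _ =>
        eventually_classSum_le hc hσ h hyp.1 hdQ hyp.2 r hε'0 hε'1
      exact hall.mono fun N hN _ _ => hN
    · exact Eventually.of_forall fun N hd0 hsf => absurd ⟨hd0, hsf⟩ hyp
  obtain ⟨N₀, hN₀⟩ := eventually_atTop.mp hev
  refine ⟨N₀, fun N hN d hd hdQ hsf r hr => ?_⟩
  have hup := hN₀ N hN d (mem_range.mpr (Nat.lt_succ_of_le hdQ)) hd hsf
  -- lower bounds from the upper ones: `∑_r U_d(r) = U`, `∑_r ρ(d, r) = 1`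
  have key := abs_sub_mul_le_of_forall_le (range d)
    (fun r' : ℕ => ∑ k ∈ (Icc 1 N).filter (fun k : ℕ => k ≡ r' [MOD d]), hbWeight c N k)
    (fun r' : ℕ => (#{ab ∈ range d ×ˢ range d | ab.1 ^ 3 + 2 * ab.2 ^ 3 ≡ r' [MOD d] ∧
          Nat.Coprime (ab.1 ^ 3 + 2 * ab.2 ^ 3) d} : ℝ) /
        (#{ab ∈ range d ×ˢ range d | Nat.Coprime (ab.1 ^ 3 + 2 * ab.2 ^ 3) d} : ℝ))
    (hU0 N) hε'0.le (sum_range_sum_filter_modEq (Icc 1 N) (hbWeight c N) hd)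
    (sum_range_classDensity_eq_one hsf) hup (mem_range.mpr hr)
  refine le_trans key ?_
  rw [card_range]
  have hdε : (d : ℝ) * (min ε 1 / Q) ≤ ε := by
    calc (d : ℝ) * (min ε 1 / Q) ≤ Q * (min ε 1 / Q) := by gcongr
      _ = min ε 1 := by field_simp
      _ ≤ ε := min_le_left _ _
  exact mul_le_mul_of_nonneg_right hdε (hU0 N)

end Literature.NumberTheory.Sieve.CubicMinorant

end
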